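import Mathlib.Analysis.Calculus.MeanValue
import Mathlib.Analysis.SpecialFunctions.Log.Deriv
import Literature.MathematicalPhysics.QuantumFieldTheory.Balaban1983to89.T4MatchingAssembly

/-!
# Spine/NE7/Targets — spine estimate NE7 (node U5 «MATCHING MODULO CONSTANTS»): the node's TARGET SHAPES BY TREE NAME,
# the NE7-proper leaf `Core` as one named shape, the node's exits BY NAME, and the kernel face of the H1L route's last step
# («log B_τ − log A⁺_τ = ∫₀¹ ∂_σ log ρ^{(σ)}_τ dσ» ⟹ `Core`)

Cell `pub-balaban-gaps` (YM blitz Y1, track G2, seat `ne7`; text of record `run/shared/lean/pub/pub-balaban-gaps/ne/NE7.md`).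
A STATEMENTS-FIRST stub in the format of `Spine/NE2/Targets` and `Spine/NE5/LeafIndex`: every `def` is a PARAMETRIC SHAPE
(a definition of a proposition, tagged `[shape]`), never a fact; every `theorem` is `[bookkeeping]` (a landed tree theorem BY
NAME) or `[folklore]` real analysis (the mean value inequality); nothing printed is used as a hypothesis; 0 sorry; axioms standard.

WHAT NE7 IS, BY TREE NAME.  Node U5 of the T⁴-continuum DAG compares the dressed partition functions of TWO runs of Bałaban's
renormalisation group on the SAME fixed torus driven by the same unit-lattice field (run A: `K` steps from spacing `L^{−K}`; run B:
`K + 1` steps from `L^{−K−1}`): `T4CauchySum.MatchingModConstants vol l₀ δ Z ∧ Summable δ` (`Target` below).  The kernel consumes the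
HYBRID form `T4MatchingAssembly.HybridNE7 l₀ vol T A B Bad W shA shB Wsh δ` whose fields are `weight` (= row NE7b,
`T4WeightBudget.RelWeightBound`), `shell` (= row NE7c, `T4IndicatorShell.ShellWeightBound`), `lt_one`, `summable` (node U4′) and
`core` — NE7's OWN term-wise half: on every good class the shell-free cores of the two runs are sandwiched with ONE `t`- and
class-independent constant per `K`, `e^{c − vol·δ_K}(A − shA) ≤ B − shB ≤ e^{c + vol·δ_K}(A − shA)`.  `Core` below is that field as a
standalone shape (so that the cell's table can name it), `core_of_hybridNE7` / `hybridNE7_of_core` record that it is LITERALLY the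
field.  Exits BY NAME: `HybridNE7.matchingModConstants` (node U5's output), `T4MatchingAssembly.hasContinuumLimit_of_hybridNE7`
(node U0: `HasContinuumLimit ∧ HasUniqueLimitPoints ∧ LimitPointsAgree`); in the explicit-hypothesis headline
`T4ContinuumYM4Torus.continuumYM4_torus_of_BetaPertH` the node enters through the spine slot
`hNE : T4ApexHybrid.HybridNE7Under D (T4Continuum.BetaPertHyp D.βfun)` (per string, via `T4MatchingClosure.stringHybridNE7_closure`).

THE H1L FACE (§3).  The lens-1 route of record for `core` (`run/shared/lean/pub/pub-balaban/t4/ROUTES-NE7.md` §L1.1, «H1L: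
straight line between the two main actions») ends, per good term `τ`, with a positive `C¹` path `σ ↦ ρ_τ(σ)` from run A⁺'s core
(`σ = 0`) to run B's core (`σ = 1`) whose logarithmic derivative differs from ONE `τ`- and `t`-independent drift `φ′_K(σ)` by at most
`vol·δ_K` («sup_V |∂_σ log ρ^{(σ)}_{τ,K} − k(σ)| ≤ vol·δ_K^{(σ)}»).  `PathLeaf` is that output as a shape and `core_of_pathLeaf` is the
one-line calculus face `PathLeaf ⟹ Core` with `c_K = φ_K(1) − φ_K(0)` (mean value inequality for `log ρ_τ − φ_K` on `[0,1]`), whence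
`hybridNE7_of_pathLeaf`.  This books NOTHING about Bałaban's objects: producing `PathLeaf` for the history-indexed densities of the
two runs is the route's whole content (its steps K1-lin(s), K1-var(s), K1-ind(s), K2c + K2c-𝐑, K3′, W-H1L-1, K2d of ROUTES-NE7 §L1.1;
census `NE7.md` §6), none of which is in print.

HONEST FRAMING.  NE7 is NOT IN PRINT ([Balaban1987RG1]–[Balaban1989LargeFieldII] bound ONE run uniformly in `ε`; no two-run
comparison is stated; [Balaban1989LargeFieldII] p. 356 defers even the one-run analysis of loop observables) and NOT PROVED here or
anywhere in the tree: 0 instance of `HybridNE7` ∕ `Core` ∕ `PathLeaf` on Bałaban's objects exists.  Fixed FINITE T⁴, rung (B)+1 —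
NOT infinite volume, NOT a mass gap, NOT Clay.  HONEST DEPENDENCY: continuum YM on T⁴ ⇐ (B) ∧ β-input ∧ nine spine estimates
(0∕9 proved).  This file changes no census value.  Printed TEMPLATE of the hybrid split (context only): [King1986] (3.10)–(3.13)
pp. 656–657; why d = 4 needs the RELATIVE form: [Balaban1989LargeFieldI] p. 175 — both as quoted in the tree's `T4HybridMatching`.
-/

noncomputable section

open Set Finset

namespace Summit.QuantumFields.BalabanUV.T4Continuum.Spine.NE7

open Literature.MathematicalPhysics.QuantumFieldTheory.Balaban1983to89
open Literature.MathematicalPhysics.QuantumFieldTheory.Balaban1983to89.T4CauchySum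
open Literature.MathematicalPhysics.QuantumFieldTheory.Balaban1983to89.T4HybridMatching
open Literature.MathematicalPhysics.QuantumFieldTheory.Balaban1983to89.T4WeightBudget
open Literature.MathematicalPhysics.QuantumFieldTheory.Balaban1983to89.T4IndicatorShell
open Literature.MathematicalPhysics.QuantumFieldTheory.Balaban1983to89.T4MatchingAssembly

/-! ## §1 The node's target and the NE7-proper leaf, as named shapes -/

/-- [shape] **NODE U5's TARGET**: the dressed partition functions of consecutive runs match modulo `t`-independent constants with
a SUMMABLE remainder — `T4CauchySum.MatchingModConstants vol l₀ δ Z ∧ Summable δ`.  A parametric definition of a proposition,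
NOT a fact; NOT IN PRINT for Bałaban's d = 4 procedure. [folklore] -/
def Target (vol l₀ : ℝ) (δ : ℕ → ℝ) (Z : ℕ → ℝ → ℝ) : Prop :=
  MatchingModConstants vol l₀ δ Z ∧ Summable δ

variable {ι : Type*} [DecidableEq ι]

/-- [shape] **THE NE7-PROPER LEAF `Core`** — the `core` field of `T4MatchingAssembly.HybridNE7` as a standalone shape on two
families of (shell-free) cores `P` (run A) and `Q` (run B): for every `K` ONE constant `c`, independent of `t` and of the class,
with `e^{c − vol·δ_K}·P ≤ Q ≤ e^{c + vol·δ_K}·P` on every good class `τ ∈ T K ∖ Bad K t`, `|t| ≤ l₀`.  NOT a fact. [folklore] -/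
def Core (l₀ vol : ℝ) (T : ℕ → Finset ι) (Bad : ℕ → ℝ → Finset ι) (P Q : ℕ → ℝ → ι → ℝ) (δ : ℕ → ℝ) : Prop :=
  ∀ K : ℕ, ∃ c : ℝ, ∀ t : ℝ, |t| ≤ l₀ → ∀ τ ∈ T K \ Bad K t,
    Real.exp (c - vol * δ K) * P K t τ ≤ Q K t τ ∧ Q K t τ ≤ Real.exp (c + vol * δ K) * P K t τ

variable {l₀ vol : ℝ} {T : ℕ → Finset ι} {A B shA shB : ℕ → ℝ → ι → ℝ} {Bad : ℕ → ℝ → Finset ι} {W Wsh δ : ℕ → ℝ}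

/-- [bookkeeping] `Core` on the cores `A − shA`, `B − shB` IS the `core` field of `HybridNE7` (projection; definitional). [folklore] -/
theorem core_of_hybridNE7 (h : HybridNE7 l₀ vol T A B Bad W shA shB Wsh δ) :
    Core l₀ vol T Bad (fun K t τ => A K t τ - shA K t τ) (fun K t τ => B K t τ - shB K t τ) δ :=
  h.core

/-- [bookkeeping] … and conversely the five leaves `weight` (NE7b) · `shell` (NE7c) · `lt_one` · `summable` (U4′) · `Core` (NE7 proper)
assemble `HybridNE7` — the tree's `hybridNE7_of_relWeightBound` BY NAME. [folklore] -/
theorem hybridNE7_of_core (hW : RelWeightBound l₀ T A B Bad W) (hSh : ShellWeightBound l₀ T A B shA shB Wsh)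
    (hlt : ∀ K, W K + Wsh K < 1) (hδ : Summable δ)
    (hcore : Core l₀ vol T Bad (fun K t τ => A K t τ - shA K t τ) (fun K t τ => B K t τ - shB K t τ) δ) :
    HybridNE7 l₀ vol T A B Bad W shA shB Wsh δ :=
  hybridNE7_of_relWeightBound hW hSh hlt hδ hcore

/-! ## §2 The node's exits BY NAME -/

/-- [bookkeeping] **NODE U5's EXIT**: `HybridNE7` with the dictionary (E1∕E2) and positivity (L1-pos) gives `Target` with the remainder
`hybridDelta vol δ (W + Wsh)` — `HybridNE7.matchingModConstants` BY NAME. [folklore] -/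
theorem target_of_hybridNE7 {Z : ℕ → ℝ → ℝ} (h : HybridNE7 l₀ vol T A B Bad W shA shB Wsh δ) (hvol : 0 < vol) (hl₀ : 0 ≤ l₀)
    (hZA : ∀ K t, |t| ≤ l₀ → Z K t = ∑ τ ∈ T K, A K t τ) (hZB : ∀ K t, |t| ≤ l₀ → Z (K + 1) t = ∑ τ ∈ T K, B K t τ)
    (hpos : ∀ K t, |t| ≤ l₀ → 0 < ∑ τ ∈ T K, A K t τ) :
    Target vol l₀ (hybridDelta vol δ (fun K => W K + Wsh K)) Z :=
  h.matchingModConstants hvol hl₀ hZA hZB hpos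

/-! NODE U0's EXIT is the tree's `T4MatchingAssembly.hasContinuumLimit_of_hybridNE7` (a `StringHybridNE7` datum per observable
string from some `K₀` on ⟹ `HasContinuumLimit ∧ HasUniqueLimitPoints ∧ LimitPointsAgree`; positivity discharged by
`T4GenFunBounds.dressedZ_pos`, the head `K < K₀` free) — cited BY NAME, not restated (dedup rule). -/

/-! ## §3 The H1L face: a positive `C¹` path per good term with a common drift ⟹ `Core` -/

/-- [shape] **THE H1L ROUTE's OUTPUT `PathLeaf`** (ROUTES-NE7 §L1.1 «OUTPUT per good term»): for every `K` ONE drift `φ` with derivative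
`φ′` on `[0,1]` (independent of `t` and of the class), and for every good term a path `ρ` with `ρ 0 = P K t τ` (run A⁺'s core), `ρ 1 = Q K t τ`
(run B's core), positive and differentiable on `[0,1]` with derivative `ρ′`, whose logarithmic derivative stays within `vol·δ_K` of the
drift: `|ρ′ σ ∕ ρ σ − φ′ σ| ≤ vol·δ K` (derivatives WITHIN `[0,1]`, so one-sided at the endpoints suffice).  In the route: `σ` = the interpolation parameter of the family `ρ₀^{(σ)}` (main action
`β(σ)·A_{s(σ)}`, E-data `σE_B^{(1)}`, pockets unscaled), `φ′ = k_K(σ)` the `V`-independent part of the transported insertion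
`−[β′A_s + βs′𝔇 + E_B^{(1)}]`.  A SHAPE; producing it for Bałaban's objects is the route's entire (unprinted) content. [folklore] -/
def PathLeaf (l₀ vol : ℝ) (T : ℕ → Finset ι) (Bad : ℕ → ℝ → Finset ι) (P Q : ℕ → ℝ → ι → ℝ) (δ : ℕ → ℝ) : Prop :=
  ∀ K : ℕ, ∃ φ φ' : ℝ → ℝ, (∀ σ ∈ Icc (0 : ℝ) 1, HasDerivWithinAt φ (φ' σ) (Icc (0 : ℝ) 1) σ) ∧
    ∀ t : ℝ, |t| ≤ l₀ → ∀ τ ∈ T K \ Bad K t, ∃ ρ ρ' : ℝ → ℝ,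
      ρ 0 = P K t τ ∧ ρ 1 = Q K t τ ∧ (∀ σ ∈ Icc (0 : ℝ) 1, 0 < ρ σ ∧ HasDerivWithinAt ρ (ρ' σ) (Icc (0 : ℝ) 1) σ) ∧
        ∀ σ ∈ Icc (0 : ℝ) 1, |ρ' σ / ρ σ - φ' σ| ≤ vol * δ K

/-- [folklore] The calculus step: a positive differentiable path on `[0,1]` whose log-derivative is within `η` of `φ′` has
`|log ρ(1) − log ρ(0) − (φ 1 − φ 0)| ≤ η` (mean value inequality for `log ρ − φ`). [folklore] -/
theorem abs_log_sub_log_sub_le_of_path {ρ ρ' φ φ' : ℝ → ℝ} {η : ℝ}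
    (hφ : ∀ σ ∈ Icc (0 : ℝ) 1, HasDerivWithinAt φ (φ' σ) (Icc (0 : ℝ) 1) σ)
    (hρ : ∀ σ ∈ Icc (0 : ℝ) 1, 0 < ρ σ ∧ HasDerivWithinAt ρ (ρ' σ) (Icc (0 : ℝ) 1) σ)
    (hbd : ∀ σ ∈ Icc (0 : ℝ) 1, |ρ' σ / ρ σ - φ' σ| ≤ η) :
    |Real.log (ρ 1) - Real.log (ρ 0) - (φ 1 - φ 0)| ≤ η := by
  have hderiv : ∀ σ ∈ Icc (0 : ℝ) 1,
      HasDerivWithinAt (fun s => Real.log (ρ s) - φ s) (ρ' σ / ρ σ - φ' σ) (Icc (0 : ℝ) 1) σ := fun σ hσ =>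
    ((hρ σ hσ).2.log (hρ σ hσ).1.ne').sub (hφ σ hσ)
  have hmv := norm_image_sub_le_of_norm_deriv_le_segment_01' hderiv
    (fun σ hσ => by simpa only [Real.norm_eq_abs] using hbd σ (Ico_subset_Icc_self hσ))
  have hre : Real.log (ρ 1) - φ 1 - (Real.log (ρ 0) - φ 0) = Real.log (ρ 1) - Real.log (ρ 0) - (φ 1 - φ 0) := by ring
  simpa only [Real.norm_eq_abs, hre] using hmv

/-- [folklore] From `|log Q − log P − c| ≤ η` with `P, Q > 0` to the two-sided multiplicative sandwich `e^{c−η}P ≤ Q ≤ e^{c+η}P`. [folklore] -/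
theorem sandwich_of_abs_log_sub_le {P Q c η : ℝ} (hP : 0 < P) (hQ : 0 < Q)
    (h : |Real.log Q - Real.log P - c| ≤ η) :
    Real.exp (c - η) * P ≤ Q ∧ Q ≤ Real.exp (c + η) * P := by
  obtain ⟨hlo, hhi⟩ := abs_le.mp h
  constructor
  · calc Real.exp (c - η) * P = Real.exp (c - η + Real.log P) := by rw [Real.exp_add, Real.exp_log hP]
      _ ≤ Real.exp (Real.log Q) := Real.exp_le_exp.mpr (by linarith)
      _ = Q := Real.exp_log hQ
  · calc Q = Real.exp (Real.log Q) := (Real.exp_log hQ).symm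
      _ ≤ Real.exp (c + η + Real.log P) := Real.exp_le_exp.mpr (by linarith)
      _ = Real.exp (c + η) * P := by rw [Real.exp_add, Real.exp_log hP]

/-- [folklore] **THE H1L FACE: `PathLeaf ⟹ Core`** with `c_K = φ_K(1) − φ_K(0)`.  Elementary real analysis; it moves the node's open
content from the sandwich to the production of the paths, nothing more. [folklore] -/
theorem core_of_pathLeaf {P Q : ℕ → ℝ → ι → ℝ} (h : PathLeaf l₀ vol T Bad P Q δ) : Core l₀ vol T Bad P Q δ := by
  intro K
  obtain ⟨φ, φ', hφ, hK⟩ := h K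
  refine ⟨φ 1 - φ 0, fun t ht τ hτ => ?_⟩
  obtain ⟨ρ, ρ', h0, h1, hρ, hbd⟩ := hK t ht τ hτ
  have hP : 0 < P K t τ := h0 ▸ (hρ 0 (left_mem_Icc.mpr zero_le_one)).1
  have hQ : 0 < Q K t τ := h1 ▸ (hρ 1 (right_mem_Icc.mpr zero_le_one)).1
  have hlog := abs_log_sub_log_sub_le_of_path hφ hρ hbd
  rw [h0, h1] at hlog
  exact sandwich_of_abs_log_sub_le hP hQ hlog

/-- [bookkeeping] **H1L END FACE**: NE7b · NE7c · `lt_one` · `Summable δ` · `PathLeaf` on the cores ⟹ `HybridNE7` (hence, by §2, node U5's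
and node U0's outputs).  CONDITIONAL on all five leaves; none is produced here. [folklore] -/
theorem hybridNE7_of_pathLeaf (hW : RelWeightBound l₀ T A B Bad W) (hSh : ShellWeightBound l₀ T A B shA shB Wsh)
    (hlt : ∀ K, W K + Wsh K < 1) (hδ : Summable δ)
    (hpath : PathLeaf l₀ vol T Bad (fun K t τ => A K t τ - shA K t τ) (fun K t τ => B K t τ - shB K t τ) δ) :
    HybridNE7 l₀ vol T A B Bad W shA shB Wsh δ :=
  hybridNE7_of_core hW hSh hlt hδ (core_of_pathLeaf hpath)

/-! ## §4 Sanity: the shapes are inhabited (trivially) -/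

/-- SANITY (non-vacuity of `PathLeaf`, hence of the face): equal positive cores, the constant path, zero drift, zero remainder.
Shows only that the clauses are jointly satisfiable. [folklore] -/
example (T : ℕ → Finset ι) (Bad : ℕ → ℝ → Finset ι) :
    PathLeaf 1 1 T Bad (fun _ _ _ => 1) (fun _ _ _ => 1) (fun _ => 0) := by
  intro K
  refine ⟨fun _ => 0, fun _ => 0, fun σ _ => (hasDerivAt_const σ (0 : ℝ)).hasDerivWithinAt, fun t _ τ _ => ?_⟩
  refine ⟨fun _ => 1, fun _ => 0, rfl, rfl, fun σ _ => ⟨one_pos, (hasDerivAt_const σ (1 : ℝ)).hasDerivWithinAt⟩,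
    fun σ _ => ?_⟩
  norm_num

/-- SANITY: the face fires on the trivial datum — `Core` with `c = 0`. [folklore] -/
example (T : ℕ → Finset ι) (Bad : ℕ → ℝ → Finset ι) :
    Core 1 1 T Bad (fun _ _ _ => 1) (fun _ _ _ => 1) (fun _ => 0) :=
  core_of_pathLeaf (l₀ := 1) (vol := 1) (T := T) (Bad := Bad) (δ := fun _ => 0) fun K =>
    ⟨fun _ => 0, fun _ => 0, fun σ _ => (hasDerivAt_const σ (0 : ℝ)).hasDerivWithinAt, fun t _ τ _ =>
      ⟨fun _ => 1, fun _ => 0, rfl, rfl, fun σ _ => ⟨one_pos, (hasDerivAt_const σ (1 : ℝ)).hasDerivWithinAt⟩,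
        fun σ _ => by norm_num⟩⟩

end Summit.QuantumFields.BalabanUV.T4Continuum.Spine.NE7

end
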